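import Literature.NumberTheory.LFunctions.QuadraticResiduePrimes
import HarnessLib

/-!
# Mertens' theorem with rate for the primes with `(D/p) = −1`

Sequel of `QuadraticResiduePrimes.lean`: for a non-square integer `D` and
`ω_D(p) = #{n mod p : n² ≡ D}` (`polyRootCountMod ![X² − D] p`; `ω_D(p) = 0` iff `D` is a
quadratic non-residue modulo `p`),

* `abs_sum_nonresidue_inv_sub_le` — for every `A` there are `c, K` with
  `|∑_{p ≤ x, ω_D(p) = 0} 1/p − ((1/2) log log x + c)| ≤ K/(log x)^{A+1}` for all `x ≥ 2`;
* `abs_sum_Ioc_nonresidue_inv_sub_le` — the window form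
  `|∑_{v < p ≤ y, ω_D(p) = 0} 1/p − (1/2)(log log y − log log v)| ≤ K/(log v)^{A+1}`
  (`2 ≤ v ≤ y`), i.e. "`S(v, y; 𝒫) = ½ log log y − ½ log log v + O(1/log v)`" in the proof of
  Lenstra–Pomerance, J. Amer. Math. Soc. **5** (1992), Thm 9.1 (there from Davenport, Ch. 7/20).

From the Chebyshev estimate `abs_theta_nonresidue_sub_le` by the tree's partial summation with
rates `Literature.NumberTheory.LFunctions.ThetaMertens.sum_primesLE_div_of_theta`. Everything is
proved; no named facts.

## References

* H. W. Lenstra Jr., C. Pomerance, J. Amer. Math. Soc. 5 (1992) 483–516, §9, proof of Thm 9.1.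
  [LenstraPomerance1992]
-/

noncomputable section

open Finset Polynomial

namespace Literature.NumberTheory.LFunctions

namespace QuadraticResiduePrimes

open Literature.NumberTheory.Sieve

variable (D : ℤ)

/-! ### Mertens' theorem with rate for the non-residue primes -/

/-- **Mertens for the non-residue primes, with rate**: for `D` not a square and every `A` there
are `c, K` with `|∑_{p ≤ x, ω_D(p) = 0} 1/p − ((1/2) log log x + c)| ≤ K/(log x)^{A+1}` for all
`x ≥ 2`. [cite: LenstraPomerance1992, §9 proof of Thm 9.1] -/
theorem abs_sum_nonresidue_inv_sub_le (hD : ¬ IsSquare D) (A : ℕ) :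
    ∃ c K : ℝ, ∀ x : ℝ, 2 ≤ x →
      |∑ p ∈ (Nat.primesLE ⌊x⌋₊).filter (fun p => polyRootCountMod ![X ^ 2 - C D] p = 0),
          (1 : ℝ) / p - (1 / 2 * Real.log (Real.log x) + c)| ≤ K / Real.log x ^ (A + 1) := by
  obtain ⟨B, hB⟩ := abs_theta_nonresidue_sub_le D hD A
  set w : ℕ → ℝ := fun p => if polyRootCountMod ![X ^ 2 - C D] p = 0 then 1 else 0 with hw
  have hθ : ∀ t : ℝ, 2 ≤ t →
      |∑ p ∈ Nat.primesLE ⌊t⌋₊, w p * Real.log p - 1 / 2 * t| ≤ B * t / Real.log t ^ (A + 1) := by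
    intro t ht
    have hs : ∑ p ∈ Nat.primesLE ⌊t⌋₊, w p * Real.log p =
        ∑ p ∈ (Nat.primesLE ⌊t⌋₊).filter (fun p => polyRootCountMod ![X ^ 2 - C D] p = 0),
          Real.log p := by
      rw [sum_filter]
      refine sum_congr rfl fun p _ => ?_
      simp only [hw]
      split_ifs <;> simp
    rw [hs, show 1 / 2 * t = t / 2 by ring]
    exact hB t ht
  obtain ⟨c, K, h⟩ := ThetaMertens.sum_primesLE_div_of_theta hθ
  refine ⟨c, K, fun x hx => ?_⟩
  have hs : ∑ p ∈ Nat.primesLE ⌊x⌋₊, w p / p =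
      ∑ p ∈ (Nat.primesLE ⌊x⌋₊).filter (fun p => polyRootCountMod ![X ^ 2 - C D] p = 0),
        (1 : ℝ) / p := by
    rw [sum_filter]
    refine sum_congr rfl fun p _ => ?_
    simp only [hw]
    split_ifs <;> simp
  rw [← hs]
  exact h x hx

/-- **Mertens over a window for the non-residue primes**: for `D` not a square and every `A`
there is `K` with `|∑_{v < p ≤ y, ω_D(p) = 0} 1/p − (1/2)(log log y − log log v)| ≤ K/(log v)^{A+1}`
for all `2 ≤ v ≤ y` — the estimate "`S(v, y; 𝒫) = ½ log log y − ½ log log v + O(1/log v)`" of the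
proof of [LP92, Thm 9.1]. [cite: LenstraPomerance1992, §9 proof of Thm 9.1] -/
theorem abs_sum_Ioc_nonresidue_inv_sub_le (hD : ¬ IsSquare D) (A : ℕ) :
    ∃ K : ℝ, ∀ v y : ℝ, 2 ≤ v → v ≤ y →
      |∑ p ∈ (Ioc ⌊v⌋₊ ⌊y⌋₊).filter
            (fun p => p.Prime ∧ polyRootCountMod ![X ^ 2 - C D] p = 0), (1 : ℝ) / p -
          1 / 2 * (Real.log (Real.log y) - Real.log (Real.log v))| ≤ K / Real.log v ^ (A + 1) := by
  obtain ⟨c, K, h⟩ := abs_sum_nonresidue_inv_sub_le D hD A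
  refine ⟨2 * K, fun v y hv hvy => ?_⟩
  have hy : 2 ≤ y := hv.trans hvy
  have hK0 : 0 ≤ K := by
    have h2 := h 2 le_rfl
    have hl : 0 < Real.log 2 ^ (A + 1) := pow_pos (Real.log_pos one_lt_two) _
    by_contra hneg
    have : K / Real.log 2 ^ (A + 1) < 0 := div_neg_of_neg_of_pos (not_le.mp hneg) hl
    linarith [abs_nonneg (∑ p ∈ (Nat.primesLE ⌊(2 : ℝ)⌋₊).filter
      (fun p => polyRootCountMod ![X ^ 2 - C D] p = 0), (1 : ℝ) / p -
        (1 / 2 * Real.log (Real.log 2) + c))]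
  set Pf : ℝ → Finset ℕ := fun t =>
    (Nat.primesLE ⌊t⌋₊).filter (fun p => polyRootCountMod ![X ^ 2 - C D] p = 0) with hPf
  -- the window set is the difference of the two filtered sets
  have hsub : Pf v ⊆ Pf y := by
    intro p hp
    rw [hPf, mem_filter, Nat.mem_primesLE] at hp ⊢
    exact ⟨⟨hp.1.1.trans (Nat.floor_mono hvy), hp.1.2⟩, hp.2⟩
  have hset : (Ioc ⌊v⌋₊ ⌊y⌋₊).filter
      (fun p => p.Prime ∧ polyRootCountMod ![X ^ 2 - C D] p = 0) = Pf y \ Pf v := by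
    ext p
    simp only [hPf, mem_filter, mem_Ioc, mem_sdiff, Nat.mem_primesLE]
    constructor
    · rintro ⟨⟨h1, h2⟩, h3, h4⟩
      exact ⟨⟨⟨h2, h3⟩, h4⟩, fun h' => absurd h'.1.1 (by omega)⟩
    · rintro ⟨⟨⟨h1, h2⟩, h3⟩, h4⟩
      refine ⟨⟨?_, h1⟩, h2, h3⟩
      by_contra h5
      exact h4 ⟨⟨by omega, h2⟩, h3⟩
  have hdiff : ∑ p ∈ Pf y \ Pf v, (1 : ℝ) / p =
      ∑ p ∈ Pf y, (1 : ℝ) / p - ∑ p ∈ Pf v, (1 : ℝ) / p := by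
    rw [← sum_sdiff hsub]; ring
  rw [hset, hdiff]
  have h1 := h y hy
  have h2 := h v hv
  have hlv : 0 < Real.log v := Real.log_pos (by linarith)
  have hmono : K / Real.log y ^ (A + 1) ≤ K / Real.log v ^ (A + 1) := by
    apply div_le_div_of_nonneg_left hK0 (pow_pos hlv _)
    exact pow_le_pow_left₀ hlv.le (Real.log_le_log (by linarith) hvy) _
  have e : ∑ p ∈ Pf y, (1 : ℝ) / p - ∑ p ∈ Pf v, (1 : ℝ) / p -
      1 / 2 * (Real.log (Real.log y) - Real.log (Real.log v)) =
      (∑ p ∈ Pf y, (1 : ℝ) / p - (1 / 2 * Real.log (Real.log y) + c)) -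
        (∑ p ∈ Pf v, (1 : ℝ) / p - (1 / 2 * Real.log (Real.log v) + c)) := by ring
  rw [e]
  calc |(∑ p ∈ Pf y, (1 : ℝ) / p - (1 / 2 * Real.log (Real.log y) + c)) -
        (∑ p ∈ Pf v, (1 : ℝ) / p - (1 / 2 * Real.log (Real.log v) + c))|
      ≤ K / Real.log y ^ (A + 1) + K / Real.log v ^ (A + 1) :=
        (abs_sub _ _).trans (add_le_add h1 h2)
    _ ≤ 2 * K / Real.log v ^ (A + 1) := by rw [mul_div_assoc]; linarith

/-! ### The count with any constant below `1/2` -/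

/-- For every `κ < 1/2`: `#{p ≤ x : ω_D(p) = 0} ≥ κ x/log x` for `x ≥ x₀(D, κ)` (half of the primes
are non-residues). [cite: LenstraPomerance1992, §9 proof of Thm 9.1] -/
theorem card_nonresidue_ge_of_lt_half (hD : ¬ IsSquare D) {κ : ℝ} (hκ : κ < 1 / 2) :
    ∃ x₀ : ℝ, ∀ x : ℝ, x₀ ≤ x →
      κ * x / Real.log x ≤
        #((Nat.primesLE ⌊x⌋₊).filter fun p => polyRootCountMod ![X ^ 2 - C D] p = 0) := by
  obtain ⟨B, hB⟩ := abs_theta_nonresidue_sub_le D hD 0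
  have hgap : 0 < 1 / 2 - κ := by linarith
  refine ⟨max 2 (Real.exp (max B 0 / (1 / 2 - κ))), fun x hx => ?_⟩
  have hx2 : 2 ≤ x := le_trans (le_max_left _ _) hx
  have hx0 : 0 < x := by linarith
  have hlogx : max B 0 / (1 / 2 - κ) ≤ Real.log x :=
    (Real.le_log_iff_exp_le hx0).2 (le_trans (le_max_right _ _) hx)
  have hlog0 : 0 < Real.log x := Real.log_pos (by linarith)
  rw [div_le_iff₀ hgap] at hlogx
  set F := (Nat.primesLE ⌊x⌋₊).filter fun p => polyRootCountMod ![X ^ 2 - C D] p = 0 with hF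
  have hθF : ∑ p ∈ F, Real.log p ≤ #F * Real.log x := by
    have h : ∀ p ∈ F, Real.log p ≤ Real.log x := by
      intro p hp
      have hpP := (mem_filter.1 hp).1
      have hp1 := (Nat.prime_of_mem_primesLE hpP).pos
      have hpx : (p : ℝ) ≤ x :=
        le_trans (by exact_mod_cast Nat.le_of_mem_primesLE hpP) (Nat.floor_le hx0.le)
      exact Real.log_le_log (by exact_mod_cast hp1) hpx
    calc ∑ p ∈ F, Real.log p ≤ ∑ p ∈ F, Real.log x := sum_le_sum h
      _ = #F * Real.log x := by rw [sum_const, nsmul_eq_mul]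
  have h1 := hB x hx2
  rw [zero_add, pow_one] at h1
  have h2 : x / 2 - B * x / Real.log x ≤ ∑ p ∈ F, Real.log p := by
    have := (abs_le.1 h1).1; linarith
  have h3 : B * x / Real.log x ≤ (1 / 2 - κ) * x := by
    rw [div_le_iff₀ hlog0]
    have hB' : B ≤ max B 0 := le_max_left _ _
    have h0' : 0 ≤ max B 0 := le_max_right _ _
    nlinarith
  have h4 : κ * x ≤ #F * Real.log x := by nlinarith
  rw [div_le_iff₀ hlog0]
  exact h4

end QuadraticResiduePrimes

end Literature.NumberTheory.LFunctions

end
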